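import Literature.Analysis.FluidPDE.Tao2016AveragedNS.TriggerToleranceWith
import Literature.Analysis.FluidPDE.Tao2016AveragedNS.TriggerCeilingWith
import Literature.Analysis.FluidPDE.Tao2016AveragedNS.CircuitShadowing
import Literature.Analysis.FluidPDE.Tao2016AveragedNS.GateCertificate
import HarnessLib

/-!
# The retuned delay circuit `delayCircuitWith K M ε`: flow, explicit Lipschitz constant, shadow
radius, and firing at rescaled time `2`

HONEST FRAMING (pub-fluidc): a low prior, high value-of-information experiment on Tao's machine
paradigm; NOT a claim that Navier–Stokes blows up. This file is pure ODE bookkeeping about the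
one-parameter family of retunings `delayCircuitWith K M ε` of Tao's delay circuit (5.5)
(`GateRetuning.lean`: the amplifier gain `ε⁻¹K¹⁰ ↦ ε⁻¹M` and the seed `ε²e^{-K¹⁰} ↦ ε²e^{-M}`,
all other couplings untouched; `M = K¹⁰` is (5.5) itself).

It supplies, for the family, the ingredients that `GateCertificate.taoGate` consumes for (5.5) —
the port list "gen-13 successor spec" items 1, 2 and the time-`2` inequality of item 5 of the cell's
`SPEC-INPUT-bp1.md`:

* §1 `delayLipschitzWith K M ε R = 4R(ε + ε²e^{-M} + ε⁻¹M + ε⁻² + K)`, the explicit Lipschitz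
  constant of the member on the sup-ball of radius `R` (`lipschitzOnWith_delayCircuitWith`, gate by
  gate from `delayCircuitWith_eq_gates` and the per-gate constants of `CircuitShadowing.lean`),
  `coe_delayLipschitzWith`, and the bounds `delayLipschitzWith_le` (`≤ 20RK¹⁰ε⁻²`, the same
  number as `delayLipschitz_le` since `M ≤ K¹⁰`) and `delayLipschitzWith_le_of_M`
  (`≤ 4R(M + K + 3)ε⁻²`: on the ray `M = p log K` the amplifier's contribution is logarithmic; the
  rotor speed `ε⁻²` and the output pump `K` are what remain — they are NOT retuned).
* §2 the FLOW `delayFlowWith K M ε σ p` of the member from an arbitrary state (global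
  well-posedness by cancellation, `GlobalWellposedness.lean`; smoothness `contDiff_delayCircuitWith`
  of `TriggerCeilingWith.lean`): `delayFlowWith_zero`, `hasDerivAt_delayFlowWith`, uniqueness
  `delayCircuitWith_solution_unique` / `delayFlowWith_eq_of_hasDerivAt`, energy conservation
  `energy_delayFlowWith`, confinement `norm_delayFlowWith_le`, continuity.
* §3 the SHADOW RADIUS `shadowRadiusWith K M ε R T θ = θ·exp(-delayLipschitzWith K M ε R · T)`
  with `budget_of_le_shadowRadiusWith` and `shadowRadiusWith_le` (`≤ θe^{-4RT/ε²}`: exponentially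
  small in the rotor speed for EVERY member — the retuning does not touch this).
* §4 FIRING AT TIME `2`: under the standing hypotheses of the family's Theorem 5.3
  (`K ≥ 2·20⁴²·42! + 16`, `3000 log K ≤ M ≤ K¹⁰`, `0 < ε ≤ e^{-10M}/K¹⁰⁰`) the output clause of
  `kickTransitionWith_explicit` (`TriggerToleranceWith.lean`) is in force from rescaled time `2`
  on, because `√2 + 924·log K/M + 1/√K ≤ 2` (`outputOnset_le_two`): `kickTransitionWith_from_two`,
  its flow form `delayFlowWith_kickInit_fires`, and the pseudo-orbit form
  `IsPseudoOrbit.fires_from_two_with` (a `δ`-pseudo-orbit issued `δ₀`-close to a tolerated kicked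
  datum has output mode within `200K⁻¹⁰ + gronwallBound δ₀ L δ t` of `1` at every `t ∈ [2,T]`).
  This is the `dat`/`tube` content of a future `GateCertificate` instance for the member, with
  cycle time `τc = 2` uniformly in `M`.

No facts, no axioms, no `sorry`; two definitions by formula (`delayLipschitzWith`,
`shadowRadiusWith`) and one by choice (`delayFlowWith`).

References: T. Tao, *Finite time blowup for an averaged three-dimensional Navier–Stokes equation*,
J. Amer. Math. Soc. 29 (2016), §5.5, Theorem 5.3, (5.5)–(5.6), pp. 28–30 [Tao2016AveragedNS];
E. Hairer, S. Nørsett, G. Wanner, *Solving ODE I*, Thm I.10.2 [HairerNorsettWanner1993].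
-/

namespace Literature.Analysis.FluidPDE.Tao2016AveragedNS

open Set Metric
open scoped NNReal

/-! ## §1. Explicit Lipschitz constant of the member on sup-balls -/

/-- **Explicit Lipschitz constant of `delayCircuitWith K M ε`** on the sup-ball of radius `R`: the
sum of the five gate constants `4|κ|R` over the couplings `ε`, `ε²e^{-M}`, `ε⁻¹M`, `ε⁻²`, `K`.
[cite: Tao2016AveragedNS, §5.5 (5.5)] -/
noncomputable def delayLipschitzWith (K M ε : ℝ) (R : ℝ≥0) : ℝ≥0 :=
  4 * ‖ε‖₊ * R + 4 * ‖ε ^ 2 * Real.exp (-M)‖₊ * R + 4 * ‖ε⁻¹ * M‖₊ * R +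
    4 * ‖(ε ^ 2)⁻¹‖₊ * R + 4 * ‖K‖₊ * R

/-- The member is `delayLipschitzWith K M ε R`-Lipschitz on the sup-ball of radius `R` (gate by
gate, via `delayCircuitWith_eq_gates`). [cite: Tao2016AveragedNS, §5.5 (5.5)] -/
theorem lipschitzOnWith_delayCircuitWith (K M ε : ℝ) (R : ℝ≥0) :
    LipschitzOnWith (delayLipschitzWith K M ε R) (delayCircuitWith K M ε)
      (closedBall (0 : Fin 5 → ℝ) R) := by
  rw [delayCircuitWith_eq_gates]
  exact ((((lipschitzOnWith_pumpOn ε 0 1 R).add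
    (lipschitzOnWith_pumpOn (ε ^ 2 * Real.exp (-M)) 0 2 R)).add
    (lipschitzOnWith_amplifierOn (ε⁻¹ * M) 1 2 R)).add
    (lipschitzOnWith_rotorOn ((ε ^ 2)⁻¹) 0 3 2 R)).add (lipschitzOnWith_pumpOn K 3 4 R)

/-- The constant in real terms: `delayLipschitzWith K M ε R = 4R(ε + ε²e^{-M} + ε⁻¹M + ε⁻² + K)`
for `ε > 0`, `K, M ≥ 0`. [cite: Tao2016AveragedNS, §5.5 (5.5)] -/
theorem coe_delayLipschitzWith {K M ε : ℝ} (hK : 0 ≤ K) (hM : 0 ≤ M) (hε : 0 < ε) (R : ℝ≥0) :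
    (delayLipschitzWith K M ε R : ℝ) =
      4 * R * (ε + ε ^ 2 * Real.exp (-M) + ε⁻¹ * M + (ε ^ 2)⁻¹ + K) := by
  simp only [delayLipschitzWith, NNReal.coe_add, NNReal.coe_mul, NNReal.coe_ofNat, coe_nnnorm,
    Real.norm_eq_abs]
  rw [abs_of_pos hε, abs_of_nonneg (by positivity : (0 : ℝ) ≤ ε ^ 2 * Real.exp (-M)),
    abs_of_nonneg (by positivity : (0 : ℝ) ≤ ε⁻¹ * M),
    abs_of_nonneg (by positivity : (0 : ℝ) ≤ (ε ^ 2)⁻¹), abs_of_nonneg hK]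
  ring

/-- At `M = K¹⁰` the family constant is the constant of (5.5). [cite: Tao2016AveragedNS, §5.5 (5.5)] -/
theorem delayLipschitzWith_pow_ten (K ε : ℝ) (R : ℝ≥0) :
    delayLipschitzWith K (K ^ 10) ε R = delayLipschitz K ε R := rfl

/-- In the regime `0 < ε ≤ 1 ≤ K`, `0 ≤ M ≤ K¹⁰` the constant is at most `20 R K¹⁰ ε⁻²` — the same
number as for (5.5) (`delayLipschitz_le`). [cite: Tao2016AveragedNS, §5.5 (5.5)] -/
theorem delayLipschitzWith_le {K M ε : ℝ} (hK : 1 ≤ K) (hM : 0 ≤ M) (hMK : M ≤ K ^ 10)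
    (hε : 0 < ε) (hε1 : ε ≤ 1) (R : ℝ≥0) :
    (delayLipschitzWith K M ε R : ℝ) ≤ 20 * R * K ^ 10 / ε ^ 2 := by
  rw [coe_delayLipschitzWith (by linarith) hM hε]
  have hR : (0 : ℝ) ≤ R := R.coe_nonneg
  have hK10 : 1 ≤ K ^ 10 := one_le_pow₀ hK
  have hKK : K ≤ K ^ 10 := by
    calc K = K ^ 1 := (pow_one K).symm
      _ ≤ K ^ 10 := pow_le_pow_right₀ hK (by norm_num)
  have hε2 : 0 < ε ^ 2 := by positivity
  have hε2le : ε ^ 2 ≤ 1 := by nlinarith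
  have hinv : 1 ≤ (ε ^ 2)⁻¹ := one_le_inv_iff₀.2 ⟨hε2, hε2le⟩
  have hexp : Real.exp (-M) ≤ 1 := Real.exp_le_one_iff.2 (by linarith)
  have h1 : ε ≤ K ^ 10 / ε ^ 2 := by
    rw [le_div_iff₀ hε2]
    calc ε * ε ^ 2 ≤ 1 * 1 := mul_le_mul hε1 hε2le hε2.le zero_le_one
      _ = 1 := one_mul 1
      _ ≤ K ^ 10 := hK10
  have h2 : ε ^ 2 * Real.exp (-M) ≤ K ^ 10 / ε ^ 2 := by
    rw [le_div_iff₀ hε2]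
    calc ε ^ 2 * Real.exp (-M) * ε ^ 2 ≤ 1 * 1 * 1 :=
          mul_le_mul (mul_le_mul hε2le hexp (Real.exp_pos _).le zero_le_one) hε2le hε2.le
            (by norm_num)
      _ = 1 := by norm_num
      _ ≤ K ^ 10 := hK10
  have h3 : ε⁻¹ * M ≤ K ^ 10 / ε ^ 2 := by
    rw [div_eq_mul_inv, mul_comm (K ^ 10)]
    refine mul_le_mul ?_ hMK hM (by positivity)
    rw [inv_le_inv₀ hε hε2]
    calc ε ^ 2 = ε * ε := pow_two ε
      _ ≤ 1 * ε := mul_le_mul_of_nonneg_right hε1 hε.le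
      _ = ε := one_mul ε
  have h4 : (ε ^ 2)⁻¹ ≤ K ^ 10 / ε ^ 2 := by
    rw [div_eq_mul_inv]
    exact le_mul_of_one_le_left (by positivity) hK10
  have h5 : K ≤ K ^ 10 / ε ^ 2 := by
    rw [div_eq_mul_inv]
    exact hKK.trans (le_mul_of_one_le_right (by positivity) hinv)
  calc 4 * (R : ℝ) * (ε + ε ^ 2 * Real.exp (-M) + ε⁻¹ * M + (ε ^ 2)⁻¹ + K)
      ≤ 4 * R * (K ^ 10 / ε ^ 2 + K ^ 10 / ε ^ 2 + K ^ 10 / ε ^ 2 + K ^ 10 / ε ^ 2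
          + K ^ 10 / ε ^ 2) := by gcongr
    _ = 20 * R * K ^ 10 / ε ^ 2 := by ring

/-- The `M`-explicit bound: for `0 < ε ≤ 1`, `K, M ≥ 0`,
`delayLipschitzWith K M ε R ≤ 4R(M + K + 3)ε⁻²`. On the ray `M = p log K` the retuned amplifier
contributes only `p log K`; the rotor speed `ε⁻²` and the output pump `K` are untouched by the
retuning. [cite: Tao2016AveragedNS, §5.5 (5.5)] -/
theorem delayLipschitzWith_le_of_M {K M ε : ℝ} (hK : 0 ≤ K) (hM : 0 ≤ M) (hε : 0 < ε)
    (hε1 : ε ≤ 1) (R : ℝ≥0) :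
    (delayLipschitzWith K M ε R : ℝ) ≤ 4 * R * (M + K + 3) / ε ^ 2 := by
  rw [coe_delayLipschitzWith hK hM hε]
  have hR : (0 : ℝ) ≤ R := R.coe_nonneg
  have hε2 : 0 < ε ^ 2 := by positivity
  have hε2le : ε ^ 2 ≤ 1 := by nlinarith
  have hinv : 1 ≤ (ε ^ 2)⁻¹ := one_le_inv_iff₀.2 ⟨hε2, hε2le⟩
  have hexp : Real.exp (-M) ≤ 1 := Real.exp_le_one_iff.2 (by linarith)
  have h1 : ε ≤ 1 / ε ^ 2 := by
    rw [le_div_iff₀ hε2]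
    calc ε * ε ^ 2 ≤ 1 * 1 := mul_le_mul hε1 hε2le hε2.le zero_le_one
      _ = 1 := one_mul 1
  have h2 : ε ^ 2 * Real.exp (-M) ≤ 1 / ε ^ 2 := by
    rw [le_div_iff₀ hε2]
    calc ε ^ 2 * Real.exp (-M) * ε ^ 2 ≤ 1 * 1 * 1 :=
          mul_le_mul (mul_le_mul hε2le hexp (Real.exp_pos _).le zero_le_one) hε2le hε2.le
            (by norm_num)
      _ = 1 := by norm_num
  have h3 : ε⁻¹ * M ≤ M / ε ^ 2 := by
    rw [div_eq_mul_inv, mul_comm M]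
    refine mul_le_mul_of_nonneg_right ?_ hM
    rw [inv_le_inv₀ hε hε2]
    calc ε ^ 2 = ε * ε := pow_two ε
      _ ≤ 1 * ε := mul_le_mul_of_nonneg_right hε1 hε.le
      _ = ε := one_mul ε
  have h4 : (ε ^ 2)⁻¹ = 1 / ε ^ 2 := (one_div _).symm
  have h5 : K ≤ K / ε ^ 2 := by
    rw [div_eq_mul_inv]
    exact le_mul_of_one_le_right hK hinv
  calc 4 * (R : ℝ) * (ε + ε ^ 2 * Real.exp (-M) + ε⁻¹ * M + (ε ^ 2)⁻¹ + K)
      ≤ 4 * R * (1 / ε ^ 2 + 1 / ε ^ 2 + M / ε ^ 2 + 1 / ε ^ 2 + K / ε ^ 2) := by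
        rw [h4]; gcongr
    _ = 4 * R * (M + K + 3) / ε ^ 2 := by ring

/-! ## §2. The flow of the member from an arbitrary state -/

/-- Uniqueness among global trajectories of the member (cancellation ⇒ confinement to the energy
ball, smoothness ⇒ local Lipschitz, `ODE_solution_unique`). [cite: Tao2016AveragedNS, §5 (ode)–(g-cancel)] -/
theorem delayCircuitWith_solution_unique (K M ε : ℝ) {X Y : ℝ → Fin 5 → ℝ}
    (hX : ∀ t, HasDerivAt X (delayCircuitWith K M ε (X t)) t)
    (hY : ∀ t, HasDerivAt Y (delayCircuitWith K M ε (Y t)) t) (h : X 0 = Y 0) : X = Y :=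
  (isCancelling_delayCircuitWith K M ε).solution_unique (contDiff_delayCircuitWith K M ε) hX hY h

/-- The member is globally well posed from EVERY state. [cite: Tao2016AveragedNS, §5 (ode)–(g-cancel)] -/
theorem delayCircuitWith_exists_solution_from (K M ε : ℝ) (p : Fin 5 → ℝ) :
    ∃ X : ℝ → Fin 5 → ℝ, X 0 = p ∧ ∀ t, HasDerivAt X (delayCircuitWith K M ε (X t)) t :=
  (isCancelling_delayCircuitWith K M ε).exists_solution (contDiff_delayCircuitWith K M ε) p

/-- **The flow of the member**: `delayFlowWith K M ε σ p` = the state at rescaled time `σ` of the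
global trajectory of `delayCircuitWith K M ε` issued from `p` (definition by choice; characterised by
`delayFlowWith_zero`, `hasDerivAt_delayFlowWith` and uniqueness `delayFlowWith_eq_of_hasDerivAt`).
[cite: Tao2016AveragedNS, §5.5 (5.5)] -/
noncomputable def delayFlowWith (K M ε : ℝ) (σ : ℝ) (p : Fin 5 → ℝ) : Fin 5 → ℝ :=
  (delayCircuitWith_exists_solution_from K M ε p).choose σ

/-- The flow starts at the datum. [cite: Tao2016AveragedNS, §5.5 (5.5)] -/
theorem delayFlowWith_zero (K M ε : ℝ) (p : Fin 5 → ℝ) : delayFlowWith K M ε 0 p = p :=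
  (delayCircuitWith_exists_solution_from K M ε p).choose_spec.1

/-- The flow solves the member's ODE for all times. [cite: Tao2016AveragedNS, §5.5 (5.5)] -/
theorem hasDerivAt_delayFlowWith (K M ε : ℝ) (p : Fin 5 → ℝ) (σ : ℝ) :
    HasDerivAt (fun σ' => delayFlowWith K M ε σ' p)
      (delayCircuitWith K M ε (delayFlowWith K M ε σ p)) σ :=
  (delayCircuitWith_exists_solution_from K M ε p).choose_spec.2 σ

/-- Uniqueness: a global trajectory of the member IS the flow line of its initial state.
[cite: Tao2016AveragedNS, §5.5 (5.5)] -/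
theorem delayFlowWith_eq_of_hasDerivAt {K M ε : ℝ} {X : ℝ → Fin 5 → ℝ}
    (hX : ∀ t, HasDerivAt X (delayCircuitWith K M ε (X t)) t) :
    (fun σ => delayFlowWith K M ε σ (X 0)) = X :=
  delayCircuitWith_solution_unique K M ε (hasDerivAt_delayFlowWith K M ε (X 0)) hX
    (delayFlowWith_zero K M ε _)

/-- At `M = K¹⁰` the family flow is the flow of (5.5). [cite: Tao2016AveragedNS, §5.5 (5.5)] -/
theorem delayFlowWith_pow_ten (K ε : ℝ) : delayFlowWith K (K ^ 10) ε = delayFlow K ε := by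
  funext σ p
  have h := delayFlowWith_eq_of_hasDerivAt (K := K) (M := K ^ 10) (ε := ε)
    (X := fun σ' => delayFlow K ε σ' p) (fun t => by
      simpa [delayCircuitWith_pow_ten] using hasDerivAt_delayFlow K ε p t)
  have := congrFun h σ
  simpa [delayFlow_zero] using this

/-- Energy is conserved along the flow. [cite: Tao2016AveragedNS, §5.5 (energy-con)] -/
theorem energy_delayFlowWith (K M ε : ℝ) (p : Fin 5 → ℝ) (σ : ℝ) :
    energy (delayFlowWith K M ε σ p) = energy p := by
  have h := delayCircuitWith_energy (hasDerivAt_delayFlowWith K M ε p) σ 0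
  rwa [delayFlowWith_zero] at h

/-- The flow line stays in the sup-ball of radius `√(energy p)`. [cite: Tao2016AveragedNS, §5.5 (energy-con)] -/
theorem norm_delayFlowWith_le (K M ε : ℝ) (p : Fin 5 → ℝ) (σ : ℝ) :
    ‖delayFlowWith K M ε σ p‖ ≤ Real.sqrt (energy p) := by
  simpa [energy_delayFlowWith] using norm_le_sqrt_energy (delayFlowWith K M ε σ p)

/-- Flow lines are continuous. [folklore] -/
theorem continuous_delayFlowWith (K M ε : ℝ) (p : Fin 5 → ℝ) :
    Continuous fun σ => delayFlowWith K M ε σ p :=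
  continuous_iff_continuousAt.2 fun σ => (hasDerivAt_delayFlowWith K M ε p σ).continuousAt

/-- A kicked trajectory of the member lives in the unit sup-ball. [cite: Tao2016AveragedNS, §5.5 (energy-con)] -/
theorem kickW_norm_le_one {K M ε κ : ℝ} {X : ℝ → Fin 5 → ℝ}
    (hX : ∀ t, HasDerivAt X (delayCircuitWith K M ε (X t)) t) (h0 : X 0 = kickInit κ)
    (hκ : κ ^ 2 ≤ 1) (t : ℝ) : ‖X t‖ ≤ 1 := by
  have := norm_le_sqrt_energy (X t)
  rwa [kickW_energy hX h0 hκ t, Real.sqrt_one] at this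

/-- A kicked trajectory of the member is a `0`-pseudo-orbit in every ball of radius `R ≥ 1`.
[cite: Tao2016AveragedNS, §5.5 (5.5)–(5.6)] -/
theorem kickW_isPseudoOrbit {K M ε κ : ℝ} {X : ℝ → Fin 5 → ℝ}
    (hX : ∀ t, HasDerivAt X (delayCircuitWith K M ε (X t)) t) (h0 : X 0 = kickInit κ)
    (hκ : κ ^ 2 ≤ 1) (T : ℝ) {R : ℝ≥0} (hR : 1 ≤ R) :
    IsPseudoOrbit (delayCircuitWith K M ε) 0 R T X :=
  IsPseudoOrbit.of_hasDerivAt hX fun t _ =>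
    (kickW_norm_le_one hX h0 hκ t).trans (by exact_mod_cast hR)

/-! ## §3. The shadow radius of the member -/

/-- **The worst-case (Grönwall) robustness radius of the member**: a forcing budget
`δ₀ + δT ≤ shadowRadiusWith K M ε R T θ := θ·exp(-delayLipschitzWith K M ε R · T)` keeps a
pseudo-orbit within `θ` of the exact trajectory on `[0,T]` (`budget_of_le_shadowRadiusWith` and the
fundamental lemma `IsPseudoOrbit.norm_sub_le`). [cite: HairerNorsettWanner1993, Thm I.10.2] -/
noncomputable def shadowRadiusWith (K M ε : ℝ) (R : ℝ≥0) (T θ : ℝ) : ℝ :=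
  θ * Real.exp (-(delayLipschitzWith K M ε R * T))

/-- At `M = K¹⁰` the family radius is the radius of (5.5). [folklore] -/
theorem shadowRadiusWith_pow_ten (K ε : ℝ) (R : ℝ≥0) (T θ : ℝ) :
    shadowRadiusWith K (K ^ 10) ε R T θ = shadowRadius K ε R T θ := rfl

/-- A budget below `shadowRadiusWith` is a Grönwall budget. [folklore] -/
theorem budget_of_le_shadowRadiusWith {K M ε T θ δ₀ δ : ℝ} {R : ℝ≥0}
    (h : δ₀ + δ * T ≤ shadowRadiusWith K M ε R T θ) :
    (δ₀ + δ * T) * Real.exp (delayLipschitzWith K M ε R * T) ≤ θ := by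
  have hE := Real.exp_pos (delayLipschitzWith K M ε R * T)
  have := mul_le_mul_of_nonneg_right h hE.le
  rw [shadowRadiusWith, mul_assoc, ← Real.exp_add, neg_add_cancel, Real.exp_zero, mul_one] at this
  exact this

/-- The Grönwall error below a budget: `gronwallBound δ₀ L δ t ≤ θ` on `[0,T]` whenever
`(δ₀ + δT)e^{LT} ≤ θ`, `δ₀, δ ≥ 0`. [cite: HairerNorsettWanner1993, Thm I.10.2] -/
theorem gronwallBound_le_of_budget_with {K M ε T θ δ₀ δ : ℝ} {R : ℝ≥0} (hδ₀ : 0 ≤ δ₀)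
    (hδ : 0 ≤ δ) (hθ : (δ₀ + δ * T) * Real.exp (delayLipschitzWith K M ε R * T) ≤ θ) {t : ℝ}
    (ht : t ∈ Icc 0 T) : gronwallBound δ₀ (delayLipschitzWith K M ε R) δ t ≤ θ := by
  have hL : (0 : ℝ) ≤ delayLipschitzWith K M ε R := NNReal.coe_nonneg _
  refine (Literature.Analysis.ODE.gronwallBound_le_mul_exp (x := t) hδ hL).trans (le_trans ?_ hθ)
  have hT : t ≤ T := ht.2
  have hT0 : 0 ≤ T := ht.1.trans ht.2
  have hsum : 0 ≤ δ₀ + δ * T := by positivity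
  gcongr

/-- **How small the radius is**: `shadowRadiusWith K M ε R T θ ≤ θ·exp(-4RT/ε²)` (`θ, T ≥ 0`,
`ε > 0`, `K, M ≥ 0`) — exponentially small in the rotor speed `ε⁻²` for EVERY member: the retuning
of the amplifier does not touch the rotor. [cite: Tao2016AveragedNS, §5.5 (5.5)] -/
theorem shadowRadiusWith_le {K M ε T θ : ℝ} {R : ℝ≥0} (hK : 0 ≤ K) (hM : 0 ≤ M) (hε : 0 < ε)
    (hT : 0 ≤ T) (hθ : 0 ≤ θ) :
    shadowRadiusWith K M ε R T θ ≤ θ * Real.exp (-(4 * R * T / ε ^ 2)) := by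
  unfold shadowRadiusWith
  refine mul_le_mul_of_nonneg_left (Real.exp_le_exp.2 (neg_le_neg ?_)) hθ
  rw [coe_delayLipschitzWith hK hM hε]
  have hR : (0 : ℝ) ≤ R := R.coe_nonneg
  have h4 : 4 * (R : ℝ) * (ε ^ 2)⁻¹ ≤
      4 * R * (ε + ε ^ 2 * Real.exp (-M) + ε⁻¹ * M + (ε ^ 2)⁻¹ + K) := by
    refine mul_le_mul_of_nonneg_left ?_ (by positivity)
    have : 0 ≤ ε + ε ^ 2 * Real.exp (-M) + ε⁻¹ * M + K := by positivity
    linarith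
  calc 4 * (R : ℝ) * T / ε ^ 2 = 4 * R * (ε ^ 2)⁻¹ * T := by ring
    _ ≤ 4 * R * (ε + ε ^ 2 * Real.exp (-M) + ε⁻¹ * M + (ε ^ 2)⁻¹ + K) * T :=
        mul_le_mul_of_nonneg_right h4 hT

/-! ## §4. Firing at rescaled time `2`, uniformly in the family -/

/-- **The cycle time `2` clears the output onset for every member**: for `K ≥ 16` and
`M ≥ 3000 log K`, `√2 + 44 log K/M + (880 log K/M + 1/√K) ≤ 2` (indeed `≤ 1.42 + 0.308 + 0.25`).
[cite: Tao2016AveragedNS, Theorem 5.3] -/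
theorem outputOnset_le_two {K M : ℝ} (hK : 16 ≤ K) (hML : 3000 * Real.log K ≤ M) :
    Real.sqrt 2 + 44 * Real.log K / M + (880 * Real.log K / M + 1 / Real.sqrt K) ≤ 2 := by
  have hlog : 0 < Real.log K := Real.log_pos (by linarith)
  have hM : 0 < M := by linarith
  have h71 := Thm53.sqrt_two_lt
  have hsK : 4 ≤ Real.sqrt K := by
    rw [show (4 : ℝ) = Real.sqrt 16 by
      rw [show (16 : ℝ) = 4 ^ 2 by norm_num, Real.sqrt_sq (by norm_num)]]
    exact Real.sqrt_le_sqrt hK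
  have hsK0 : 0 < Real.sqrt K := by linarith
  have h1 : 1 / Real.sqrt K ≤ 1 / 4 := by
    rw [div_le_div_iff₀ hsK0 (by norm_num)]; linarith
  have h2 : 44 * Real.log K / M + 880 * Real.log K / M ≤ 924 / 3000 := by
    rw [← add_div, div_le_div_iff₀ hM (by norm_num)]
    nlinarith
  linarith

/-- **The kicked member has fired by rescaled time `2`.** Under the standing hypotheses of the
family's Theorem 5.3 and a tolerated trigger pre-load `0 ≤ κ ≤ kickToleranceWith K M ε`, a
trajectory of `delayCircuitWith K M ε` from `kickInit κ` has `|ã - 1| ≤ 200K⁻¹⁰` and every other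
mode `≤ 200K⁻¹⁰` at every `t ≥ 2` (`kickTransitionWith_explicit` + `outputOnset_le_two`; `κ = 0`
is the designed datum (5.6), `kickInit_zero`). [cite: Tao2016AveragedNS, Theorem 5.3] -/
theorem kickTransitionWith_from_two {K M ε κ : ℝ} {X : ℝ → Fin 5 → ℝ}
    (hK : 2 * 20 ^ 42 * (Nat.factorial 42 : ℝ) + 16 ≤ K) (hML : 3000 * Real.log K ≤ M)
    (hMK : M ≤ K ^ 10) (hε : 0 < ε) (hεle : ε ≤ Real.exp (-(10 * M)) / K ^ 100)
    (hκ0 : 0 ≤ κ) (hκ : κ ≤ kickToleranceWith K M ε) (h0 : X 0 = kickInit κ)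
    (hX : ∀ t, HasDerivAt X (delayCircuitWith K M ε (X t)) t) {t : ℝ} (ht : 2 ≤ t) :
    |X t 4 - 1| ≤ 200 / K ^ 10 ∧ ∀ i : Fin 5, i ≠ 4 → |X t i| ≤ 200 / K ^ 10 := by
  obtain ⟨tc, htc, -, hout⟩ := kickTransitionWith_explicit hK hML hMK hε hεle hκ0 hκ h0 hX
  have h16 : 16 ≤ K := by
    have : (0 : ℝ) ≤ 2 * 20 ^ 42 * (Nat.factorial 42 : ℝ) := by positivity
    linarith
  have h2 := outputOnset_le_two h16 hML
  have htc' : tc ≤ Real.sqrt 2 + 44 * Real.log K / M := by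
    have := (abs_sub_le_iff.1 htc).1; linarith
  exact hout t (by linarith)

/-- The same for the FLOW: from a tolerated kicked datum the member's flow line has fired at every
rescaled time `σ ≥ 2`. [cite: Tao2016AveragedNS, Theorem 5.3] -/
theorem delayFlowWith_kickInit_fires {K M ε κ : ℝ}
    (hK : 2 * 20 ^ 42 * (Nat.factorial 42 : ℝ) + 16 ≤ K) (hML : 3000 * Real.log K ≤ M)
    (hMK : M ≤ K ^ 10) (hε : 0 < ε) (hεle : ε ≤ Real.exp (-(10 * M)) / K ^ 100)
    (hκ0 : 0 ≤ κ) (hκ : κ ≤ kickToleranceWith K M ε) {σ : ℝ} (hσ : 2 ≤ σ) :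
    |delayFlowWith K M ε σ (kickInit κ) 4 - 1| ≤ 200 / K ^ 10 ∧
      ∀ i : Fin 5, i ≠ 4 → |delayFlowWith K M ε σ (kickInit κ) i| ≤ 200 / K ^ 10 :=
  kickTransitionWith_from_two (X := fun σ' => delayFlowWith K M ε σ' (kickInit κ)) hK hML hMK hε
    hεle hκ0 hκ (delayFlowWith_zero K M ε _) (hasDerivAt_delayFlowWith K M ε _) hσ

/-- The arithmetic of the standing hypotheses of the family's Theorem 5.3: `K ≥ 16`, `M ≥ 1`,
`ε ≤ 1` and `169MK²⁰ε² ≤ 1` (the first conjuncts of `ceiling_params` of `TriggerChannelWith`,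
re-derived here so that this file depends on `TriggerToleranceWith` / `TriggerCeilingWith` only).
[folklore] -/
theorem flow_params {K M ε : ℝ} (hK : 2 * 20 ^ 42 * (Nat.factorial 42 : ℝ) + 16 ≤ K)
    (hML : 3000 * Real.log K ≤ M) (hMK : M ≤ K ^ 10) (hε : 0 < ε)
    (hεle : ε ≤ Real.exp (-(10 * M)) / K ^ 100) :
    16 ≤ K ∧ 1 ≤ M ∧ ε ≤ 1 ∧ 169 * M * K ^ 20 * ε ^ 2 ≤ 1 := by
  have hK16 : 16 ≤ K := by
    have : (0 : ℝ) ≤ 2 * 20 ^ 42 * (Nat.factorial 42 : ℝ) := by positivity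
    linarith
  obtain ⟨hlog2, -, hlog0⟩ := Thm53With.log_facts hK16
  have hM0 : 0 < M := by linarith
  have hM1 : 1 ≤ M := by linarith
  obtain ⟨hε1, -, hε100, -⟩ := Thm53With.eps_facts hK16 hM0 hMK hε hεle
  have h169 : 169 * M * K ^ 20 * ε ^ 2 ≤ 1 := by
    have hεsq : ε ^ 2 ≤ (1 / K ^ 100) ^ 2 := pow_le_pow_left₀ hε.le hε100 2
    have hK170 : (169 : ℝ) ≤ K ^ 170 :=
      le_trans (by norm_num) (pow_le_pow_left₀ (by norm_num) hK16 170)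
    have hK0 : 0 < K := by linarith
    calc 169 * M * K ^ 20 * ε ^ 2 ≤ 169 * K ^ 10 * K ^ 20 * (1 / K ^ 100) ^ 2 := by
          have h3 : 169 * M * K ^ 20 ≤ 169 * K ^ 10 * K ^ 20 :=
            mul_le_mul_of_nonneg_right (mul_le_mul_of_nonneg_left hMK (by norm_num)) (by positivity)
          exact mul_le_mul h3 hεsq (by positivity) (by positivity)
      _ = 169 * K ^ 30 / K ^ 200 := by field_simp
      _ ≤ 1 := by
          rw [div_le_one (by positivity)]
          calc (169 : ℝ) * K ^ 30 ≤ K ^ 170 * K ^ 30 := mul_le_mul_of_nonneg_right hK170 (by positivity)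
            _ = K ^ 200 := by ring
  exact ⟨hK16, hM1, hε1, h169⟩

/-- **Firing from time `2` along pseudo-orbits of the member.** A `δ`-pseudo-orbit `Y` of
`delayCircuitWith K M ε` over `[0,T]` in the sup-ball of radius `R ≥ 1`, issued `δ₀`-close to a
tolerated kicked datum `kickInit κ` (`0 ≤ κ ≤ kickToleranceWith K M ε`), has at every `t ∈ [2,T]`
output mode within `200K⁻¹⁰ + gronwallBound δ₀ (delayLipschitzWith K M ε R) δ t` of `1` and every
other mode at most that — Theorem 5.3 for the member, kick and defect at once, from the FIXED
rescaled time `2` on, uniformly in `3000 log K ≤ M ≤ K¹⁰`. [cite: Tao2016AveragedNS, Theorem 5.3] -/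
theorem IsPseudoOrbit.fires_from_two_with {K M ε κ δ T δ₀ : ℝ} {R : ℝ≥0} {Y : ℝ → Fin 5 → ℝ}
    (hY : IsPseudoOrbit (delayCircuitWith K M ε) δ R T Y) (hR : 1 ≤ R)
    (hK : 2 * 20 ^ 42 * (Nat.factorial 42 : ℝ) + 16 ≤ K) (hML : 3000 * Real.log K ≤ M)
    (hMK : M ≤ K ^ 10) (hε : 0 < ε) (hεle : ε ≤ Real.exp (-(10 * M)) / K ^ 100)
    (hκ0 : 0 ≤ κ) (hκ : κ ≤ kickToleranceWith K M ε) (h0 : ‖Y 0 - kickInit κ‖ ≤ δ₀)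
    {t : ℝ} (ht2 : 2 ≤ t) (htT : t ≤ T) :
    |Y t 4 - 1| ≤ 200 / K ^ 10 + gronwallBound δ₀ (delayLipschitzWith K M ε R) δ t ∧
      ∀ i : Fin 5, i ≠ 4 →
        |Y t i| ≤ 200 / K ^ 10 + gronwallBound δ₀ (delayLipschitzWith K M ε R) δ t := by
  obtain ⟨X, hX0, hX⟩ := exists_solution_kickInit_with K M ε κ
  -- the tolerated pre-load is (much) less than one
  obtain ⟨hK16, hM1, -, h169⟩ := flow_params hK hML hMK hε hεle
  have hκ1 : κ ^ 2 ≤ 1 := by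
    have hK1 : 1 ≤ K := by linarith
    have hexp : Real.exp (-M) ≤ 1 := Real.exp_le_one_iff.2 (by linarith)
    have hK10 : K ^ 10 ≤ K ^ 20 := pow_le_pow_right₀ hK1 (by norm_num)
    have hpos : 0 ≤ ε ^ 2 * K ^ 20 := by positivity
    have hκle : κ ≤ 1 :=
      calc κ ≤ kickToleranceWith K M ε := hκ
        _ = ε ^ 2 * Real.exp (-M) * K ^ 10 := rfl
        _ ≤ ε ^ 2 * 1 * K ^ 20 := by gcongr
        _ = 1 * (ε ^ 2 * K ^ 20) := by ring
        _ ≤ 169 * M * (ε ^ 2 * K ^ 20) := mul_le_mul_of_nonneg_right (by linarith) hpos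
        _ = 169 * M * K ^ 20 * ε ^ 2 := by ring
        _ ≤ 1 := h169
    nlinarith
  have hXpo := kickW_isPseudoOrbit hX hX0 hκ1 T hR
  have h00 : ‖Y 0 - X 0‖ ≤ δ₀ := by rwa [hX0]
  have hsub := hY.norm_sub_le (lipschitzOnWith_delayCircuitWith K M ε R) hXpo h00
    (t := t) ⟨by linarith, htT⟩
  rw [add_zero] at hsub
  obtain ⟨ha, hi⟩ := kickTransitionWith_from_two hK hML hMK hε hεle hκ0 hκ hX0 hX ht2
  exact ⟨abs_sub_le_of_norm_sub_le hsub ha, fun i hne => abs_le_of_norm_sub_le hsub (hi i hne)⟩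

/-- **Firing on a budget, from time `2`.** If moreover the forcing budget obeys
`δ₀ + δT ≤ shadowRadiusWith K M ε R T θ` (`δ ≥ 0`), the tolerance is `200K⁻¹⁰ + θ` on `[2,T]`.
[cite: Tao2016AveragedNS, Theorem 5.3] -/
theorem IsPseudoOrbit.fires_from_two_of_le_shadowRadiusWith {K M ε κ δ T δ₀ θ : ℝ} {R : ℝ≥0}
    {Y : ℝ → Fin 5 → ℝ} (hY : IsPseudoOrbit (delayCircuitWith K M ε) δ R T Y) (hR : 1 ≤ R)
    (hK : 2 * 20 ^ 42 * (Nat.factorial 42 : ℝ) + 16 ≤ K) (hML : 3000 * Real.log K ≤ M)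
    (hMK : M ≤ K ^ 10) (hε : 0 < ε) (hεle : ε ≤ Real.exp (-(10 * M)) / K ^ 100)
    (hκ0 : 0 ≤ κ) (hκ : κ ≤ kickToleranceWith K M ε) (h0 : ‖Y 0 - kickInit κ‖ ≤ δ₀)
    (hδ : 0 ≤ δ) (hθ : δ₀ + δ * T ≤ shadowRadiusWith K M ε R T θ)
    {t : ℝ} (ht2 : 2 ≤ t) (htT : t ≤ T) :
    |Y t 4 - 1| ≤ 200 / K ^ 10 + θ ∧ ∀ i : Fin 5, i ≠ 4 → |Y t i| ≤ 200 / K ^ 10 + θ := by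
  have hg := gronwallBound_le_of_budget_with (K := K) (M := M) (ε := ε) (R := R)
    ((norm_nonneg _).trans h0) hδ (budget_of_le_shadowRadiusWith hθ) (t := t) ⟨by linarith, htT⟩
  obtain ⟨ha, hi⟩ := hY.fires_from_two_with hR hK hML hMK hε hεle hκ0 hκ h0 ht2 htT
  exact ⟨ha.trans (by linarith), fun i hne => (hi i hne).trans (by linarith)⟩

end Literature.Analysis.FluidPDE.Tao2016AveragedNS
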